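import Summits.QuantumAdvantage.QuantumAdvantage.Theorems.LinnikCubicClassGroupsDegreeOnePrimesEscapeDivisionPNTIntervals
import Summits.QuantumAdvantage.QuantumAdvantage.Theorems.LinnikCubicClassGroupsDegreeOnePrimesEscapeSplittingTypeDivision
import Summits.QuantumAdvantage.QuantumAdvantage.Theorems.LinnikCubicClassGroupsDegreeOnePrimesEscapeSplitPrimesPNT
import Summits.QuantumAdvantage.QuantumAdvantage.Theorems.LinnikCubicClassGroupsDegreeOnePrimesEscapeSplittingTypePNTGaloisPrime
import Summits.QuantumAdvantage.QuantumAdvantage.Theorems.LinnikCubicClassGroupsDegreeOnePrimesEscapeSplittingTypePNTPureCubic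
import HarnessLib

/-!
# Primes with a prescribed splitting type in every interval `(x, 2x]`, `x ≥ |d_K|^L`

Topic `Summits/QuantumAdvantage/QuantumAdvantage/Theorems`, cell B2b-1 (linnik-cubic), PART A (gen 11);
helper toward the crux `DegreeOnePrimesEscape` (stmt-QuantumAdvantage-11543) of route
`LinnikCubicClassGroups`.  HONEST FRAMING: the value of this file is a THEOREM (kernel-checked, GRH-free,
Siegel-free, no hypothesis) — NOT summit progress.

Bertrand-type consequences of the division prime number theorem in intervals
(`exists_frobenius_division_mem_Ioc`, gen 10) read through the splitting-type dictionaries of this generation: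

* `exists_prime_splittingType_mem_Ioc_of_symmetric` — for an `S_n`-field `K` of degree `n`, EVERY partition
  `T` of `n` and every `x ≥ |d_K|^L`: a prime `p ∈ (x, 2x]` with `splittingType K p = T`;
* `exists_splitPrime_mem_Ioc` — for EVERY number field `K` of degree `n > 1` and every `x ≥ |d_K|^L`: a prime
  `p ∈ (x, 2x]` that splits completely in `K`;
* `exists_prime_splittingType_mem_Ioc_cubic` — every non-Galois cubic field: primes of each of the three
  splitting types `{1,1,1}, {1,2}, {3}` in every `(x, 2x]`, `x ≥ |d_K|^L`;
* `exists_inertPrime_mem_Ioc_cyclicCubic` — every cyclic cubic field: an inert prime in every `(x, 2x]`.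

Unconditional, `L = L(n)` inexplicit. [cite: LagariasMontgomeryOdlyzko1979, Theorem 1.1]
-/

noncomputable section

open scoped NumberField nonZeroDivisors
open Finset Real Ideal NumberField
open Literature.NumberTheory.NumberFields Literature.NumberTheory.LFunctions
  Literature.NumberTheory.LFunctions.NumberField

namespace Summit.QuantumAdvantage.QuantumAdvantage.Theorems.DegreeOnePrimesEscape

set_option maxHeartbeats 1600000 in
/-- **Every splitting type in every interval `(x, 2x]`, `x ≥ |d_K|^L`, for `S_n`-fields.**  Unconditional.
[cite: LagariasMontgomeryOdlyzko1979, Theorem 1.1] -/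
theorem exists_prime_splittingType_mem_Ioc_of_symmetric (n : ℕ) [NeZero n] (hn : 1 < n) :
    ∃ L : ℝ, 0 < L ∧ ∀ (K : Type) [Field K] [NumberField K], Module.finrank ℚ K = n →
      (∀ (M : Type) [Field M] [NumberField M] [IsGalois ℚ M],
        (K →ₐ[ℚ] M) → n.factorial ≤ Module.finrank ℚ M) →
      ∀ T : Multiset ℕ, T.sum = n → (∀ f ∈ T, 0 < f) →
        ∀ x : ℝ, ((NumberField.discr K).natAbs : ℝ) ^ L ≤ x →
          ∃ p : ℕ, p.Prime ∧ x < p ∧ (p : ℝ) ≤ 2 * x ∧ splittingType K p = T := by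
  classical
  have hnf : 1 < n.factorial := lt_of_lt_of_le hn (Nat.self_le_factorial n)
  obtain ⟨L₀, hL₀, h⟩ := exists_frobenius_division_mem_Ioc n.factorial hnf
  refine ⟨n.factorial * L₀, by positivity, fun K _ _ hK hSn T hTsum hTpos x hx => ?_⟩
  obtain ⟨N, _, _, hGal, hdeg, K', e, ψ, hstab, hdN⟩ := symmetricClosure n K hK hSn
  haveI := hGal
  set d : ℝ := ((NumberField.discr K).natAbs : ℝ) with hd
  have hd3 : (3 : ℝ) ≤ d := three_le_natAbs_discr_real K (by rw [hK]; exact hn)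
  have hxN : ((NumberField.discr N).natAbs : ℝ) ^ L₀ ≤ x := by
    have hdNR : ((NumberField.discr N).natAbs : ℝ) ≤ d ^ (n.factorial : ℝ) := by
      rw [Real.rpow_natCast, hd]; exact_mod_cast hdN
    calc ((NumberField.discr N).natAbs : ℝ) ^ L₀ ≤ (d ^ (n.factorial : ℝ)) ^ L₀ :=
          Real.rpow_le_rpow (Nat.cast_nonneg _) hdNR hL₀.le
      _ = d ^ ((n.factorial : ℝ) * L₀) := by rw [← Real.rpow_mul (by linarith)]
      _ ≤ x := hx
  have hcardFin : Fintype.card (Fin n) = n := Fintype.card_fin n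
  obtain ⟨τ, hτ⟩ := exists_fullCycleType_eq (α := Fin n) T (by rw [hcardFin]; exact hTsum) hTpos
  rw [hcardFin] at hτ
  obtain ⟨p, hp, hxp, hp2, hpN, hfrob⟩ := h N hdeg (ψ.symm τ) x hxN
  refine ⟨p, hp, hxp, hp2, ?_⟩
  rw [ArithmeticallyEquivalent.of_algEquiv e p hp,
    (frobenius_division_iff_splittingType_eq K' ψ hstab (ψ.symm τ) hp hpN).mp hfrob, MulEquiv.apply_symm_apply, hτ]

set_option maxHeartbeats 1600000 in
/-- **A completely split prime in every interval `(x, 2x]`, `x ≥ |d_K|^L`, for every number field `K` of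
degree `n > 1`.**  Unconditional. [cite: LagariasMontgomeryOdlyzko1979, Theorem 1.1] -/
theorem exists_splitPrime_mem_Ioc (n : ℕ) (hn : 1 < n) :
    ∃ L : ℝ, 0 < L ∧ ∀ (K : Type) [Field K] [NumberField K], Module.finrank ℚ K = n →
      ∀ x : ℝ, ((NumberField.discr K).natAbs : ℝ) ^ L ≤ x →
        ∃ p : ℕ, p.Prime ∧ x < p ∧ (p : ℝ) ≤ 2 * x ∧ splittingType K p = Multiset.replicate n 1 := by
  classical
  have hdeg : ∀ m : ℕ, ∃ L : ℝ, 0 < L ∧ (1 < m → ∀ (N : Type) [Field N] [NumberField N] [IsGalois ℚ N],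
      Module.finrank ℚ N = m → ∀ σ : N ≃ₐ[ℚ] N, ∀ x : ℝ, ((NumberField.discr N).natAbs : ℝ) ^ L ≤ x →
        ∃ p : ℕ, p.Prime ∧ x < p ∧ (p : ℝ) ≤ 2 * x ∧ ¬ ((p : ℤ) ∣ NumberField.discr N) ∧
          ∃ (Q : Ideal (𝓞 N)) (_ : Q.IsMaximal) (_ : Q.LiesOver (span {(p : ℤ)})) (φ g : N ≃ₐ[ℚ] N),
            IsArithFrobAt ℤ φ Q ∧ Q.inertia (N ≃ₐ[ℚ] N) = ⊥ ∧
              Subgroup.zpowers (g * φ * g⁻¹) = Subgroup.zpowers σ) := by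
    intro m
    by_cases hm : 1 < m
    · obtain ⟨L, hL, h⟩ := exists_frobenius_division_mem_Ioc m hm
      exact ⟨L, hL, fun _ => h⟩
    · exact ⟨1, one_pos, fun h => absurd h hm⟩
  choose Lf hLf hI using hdeg
  set S : Finset ℕ := Finset.range (n.factorial + 1) with hS
  set L : ℝ := (n.factorial : ℝ) * ∑ m ∈ S, Lf m with hL
  have hmemS : ∀ m ≤ n.factorial, m ∈ S := fun m hm => Finset.mem_range.mpr (Nat.lt_succ_of_le hm)
  have hsum1 : ∀ m ≤ n.factorial, Lf m ≤ ∑ m ∈ S, Lf m := fun m hm =>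
    Finset.single_le_sum (f := Lf) (fun i _ => (hLf i).le) (hmemS m hm)
  have hLpos : 0 < L := by
    have : 0 < ∑ m ∈ S, Lf m := lt_of_lt_of_le (hLf 0) (hsum1 0 (Nat.zero_le _))
    rw [hL]; positivity
  refine ⟨L, hLpos, fun K _ _ hK x hx => ?_⟩
  obtain ⟨N, _, _, hGal, hNle, hKN, ⟨f⟩, hsep, hdN⟩ := exists_galoisClosure K
  haveI := hGal
  rw [hK] at hNle hKN
  set m := Module.finrank ℚ N with hmdef
  have hm1 : 1 < m := lt_of_lt_of_le hn hKN
  set d : ℝ := ((NumberField.discr K).natAbs : ℝ) with hd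
  have hd3 : (3 : ℝ) ≤ d := three_le_natAbs_discr_real K (by rw [hK]; exact hn)
  have hd1 : (1 : ℝ) ≤ d := by linarith
  have hxN : ((NumberField.discr N).natAbs : ℝ) ^ Lf m ≤ x := by
    have hdNR : ((NumberField.discr N).natAbs : ℝ) ≤ d ^ (m : ℝ) := by
      rw [Real.rpow_natCast, hd]; exact_mod_cast hdN
    have h3 : (m : ℝ) * Lf m ≤ L := by
      rw [hL]
      have hmf : (m : ℝ) ≤ n.factorial := by exact_mod_cast hNle
      exact mul_le_mul hmf (hsum1 m hNle) (hLf m).le (by positivity)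
    calc ((NumberField.discr N).natAbs : ℝ) ^ Lf m ≤ (d ^ (m : ℝ)) ^ Lf m :=
          Real.rpow_le_rpow (Nat.cast_nonneg _) hdNR (hLf m).le
      _ = d ^ ((m : ℝ) * Lf m) := by rw [← Real.rpow_mul (by linarith)]
      _ ≤ d ^ L := Real.rpow_le_rpow_of_exponent_le hd1 h3
      _ ≤ x := hx
  obtain ⟨p, hp, hxp, hp2, hpN, hfrob⟩ := hI m hm1 N rfl 1 x hxN
  refine ⟨p, hp, hxp, hp2, ?_⟩
  rw [← hK]
  exact (splitsCompletely_iff_frobenius_division_one f hsep hp hpN).mpr hfrob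

/-- **The three splitting types of a non-Galois cubic field in every interval `(x, 2x]`, `x ≥ |d_K|^L`.**
Unconditional. [cite: LagariasMontgomeryOdlyzko1979, Theorem 1.1] -/
theorem exists_prime_splittingType_mem_Ioc_cubic :
    ∃ L : ℝ, 0 < L ∧ ∀ (K : Type) [Field K] [NumberField K], Module.finrank ℚ K = 3 → ¬ IsGalois ℚ K →
      ∀ x : ℝ, ((NumberField.discr K).natAbs : ℝ) ^ L ≤ x →
        (∃ p : ℕ, p.Prime ∧ x < p ∧ (p : ℝ) ≤ 2 * x ∧ splittingType K p = {1, 1, 1}) ∧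
        (∃ p : ℕ, p.Prime ∧ x < p ∧ (p : ℝ) ≤ 2 * x ∧ splittingType K p = {1, 2}) ∧
        (∃ p : ℕ, p.Prime ∧ x < p ∧ (p : ℝ) ≤ 2 * x ∧ splittingType K p = {3}) := by
  obtain ⟨L, hL, h⟩ := exists_prime_splittingType_mem_Ioc_of_symmetric 3 (by norm_num)
  refine ⟨L, hL, fun K _ _ h3 hKng x hx => ?_⟩
  have hS := h K h3 (fun M _ _ _ f => factorial_three_le_finrank_of_not_isGalois h3 hKng M f)
  exact ⟨hS {1, 1, 1} (by decide) (by decide) x hx, hS {1, 2} (by decide) (by decide) x hx,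
    hS {3} (by decide) (by decide) x hx⟩

set_option maxHeartbeats 1600000 in
/-- **An inert prime in every interval `(x, 2x]`, `x ≥ |d_K|^L`, for every cyclic cubic field.**
Unconditional. [cite: LagariasMontgomeryOdlyzko1979, Theorem 1.1] -/
theorem exists_inertPrime_mem_Ioc_cyclicCubic :
    ∃ L : ℝ, 0 < L ∧ ∀ (K : Type) [Field K] [NumberField K] [IsGalois ℚ K], Module.finrank ℚ K = 3 →
      ∀ x : ℝ, ((NumberField.discr K).natAbs : ℝ) ^ L ≤ x →
        ∃ p : ℕ, p.Prime ∧ x < p ∧ (p : ℝ) ≤ 2 * x ∧ splittingType K p = {3} := by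
  classical
  obtain ⟨L, hL, h⟩ := exists_frobenius_division_mem_Ioc 3 (by norm_num)
  refine ⟨L, hL, fun K _ _ _ h3 x hx => ?_⟩
  haveI := Fact.mk Nat.prime_three
  have hcard : Nat.card (K ≃ₐ[ℚ] K) = 3 := by rw [IsGalois.card_aut_eq_finrank, h3]
  obtain ⟨σ, hσ⟩ : ∃ σ : K ≃ₐ[ℚ] K, σ ≠ 1 := by
    by_contra hall
    push Not at hall
    have : Nat.card (K ≃ₐ[ℚ] K) = 1 :=
      Nat.card_eq_one_iff_unique.mpr ⟨⟨fun a b => by rw [hall a, hall b]⟩, ⟨1⟩⟩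
    omega
  obtain ⟨p, hp, hxp, hp2, -, Q, hQmax, hQover, φ, g, hφ, hI, hg⟩ := h K h3 σ x hx
  refine ⟨p, hp, hxp, hp2, ?_⟩
  -- `φ ≠ 1` (its conjugate generates `⟨σ⟩ ≠ ⊥`), so `φ` has order `3` and `p` is inert
  have hφ1 : φ ≠ 1 := by
    intro h1
    rw [h1, mul_one, mul_inv_cancel, Subgroup.zpowers_one_eq_bot, eq_comm, Subgroup.zpowers_eq_bot] at hg
    exact hσ hg
  have hord : orderOf φ = 3 := by
    have hdvd : orderOf φ ∣ 3 := hcard ▸ orderOf_dvd_natCard φ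
    rcases (Nat.dvd_prime Nat.prime_three).mp hdvd with h1 | h2
    · exact absurd (orderOf_eq_one_iff.mp h1) hφ1
    · exact h2
  rw [splittingType_eq_replicate_orderOf hp Q hφ hI, h3, hord]
  rfl

end Summit.QuantumAdvantage.QuantumAdvantage.Theorems.DegreeOnePrimesEscape

end
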